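import Summits.CriticalPhenomena.CardyFormulaZ2.Theorems.CardyComplexConeEdgeCoherenceHarmonicSplit
import Summits.CriticalPhenomena.CardyFormulaZ2.Theorems.CardyComplexConeEdgeCoherenceHarmonicSplitMorera

/-!
# The harmonic split of `CardyComplexCone.EdgeCoherence`, part 3: the WEAK alternating mode is all the route needs

Crux `Summit.CriticalPhenomena.CardyFormulaZ2.Theses.CardyComplexCone.EdgeCoherence` (stmt-CriticalPhenomena-11385), route
`CardyComplexCone`, sub-problem `CriticalPhenomena/CardyFormulaZ2`. Content by crux strategist
`planner-cstrat-stmt-CriticalPhenomena-11385-s2-0` (remarks of `Cruxes/EdgeCoherence/Lines/harmonic_split.lean` v2, STRATEGY-CENSUS (s2)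
§Strengthen S⁺⁺); landed by the line lead `prover-line-stmt-CriticalPhenomena-11385-c2-0` as a helper file `--supports stmt-CriticalPhenomena-11385`
so that the tenure planner's re-glue of `closes` has an importable target.

`CoherentMorera` (stmt-CriticalPhenomena-11388, proved) uses `EdgeCoherence` only through `ScaledNull P₀ ∨ ScaledNull P₂`; the weak
(test-function) nullity of the alternating pairing `P₂ Λ φ = Σ_v (E₀ − E₁ + E₂ − E₃)(v) ∂φ(δv)` (scaled by `δ^{5/3}`) is therefore ALL the route
needs from this crux:

* `WeakAlternatingModeNull` — for every Dobrushin domain, every guarded discretisation family and every admissible test function,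
  `ScaledNull (P2 Λ φ)` (nothing asserted);
* `weakAlternatingModeNull_of_alternatingModeNull : AlternatingModeNull → WeakAlternatingModeNull` (landed `scaledNull_P2_of_alternatingModeNull`);
* `coherentMoreraConclusion_of_weakAlternatingModeNull : WeakAlternatingModeNull → EdgePrecompact →` both conclusions of `CoherentMorera`
  (registered sub-goal; stated over `ScaledNull (PV Λ φ)` / `VertexPrecompactAt D Λ` of `CardyComplexConeDefs` — the `CoherentMorera`-typed
  one-liner `fun hW _ hP => …` is deferred until the route file's 2026-08-17T16:01Z re-render, which re-imported the FermionicObservable cone and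
  changed the constants `winding`/`passageSum` inside the route decls, is repaired: see the lead's ROUTE-RENDER-INCIDENT.md on the item).

References: H. Duminil-Copin, S. Smirnov, *Conformal invariance of lattice models*, Clay Math. Proc. 15 (2012), §8 (Prop. 8.6, Conj. 8.7);
H. Duminil-Copin, *Parafermionic observables and their applications*, arXiv:1208.3787, Prop. 4.
-/

noncomputable section

namespace Summit.CriticalPhenomena.CardyFormulaZ2.Cruxes.EdgeCoherence.HarmonicSplit

open scoped BigOperators Topology
open Filter Set MeasureTheory
open Literature.Probability.LatticeModels Literature.Probability.RandomPlanarGeometry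
open Literature.Probability.Percolation (BondConfig bondPercolation half)
open Summit.CriticalPhenomena.CardyFormulaZ2.Theses.CardyComplexCone (EdgeCoherence EdgePrecompact)
open Summit.CriticalPhenomena.CardyFormulaZ2.Cruxes.CoherentMorera.FinitaryGreenPairing
  (Guards TestFn ScaledNull P0 P2 PV VertexPrecompactAt scaledNull_of_sub_of_or
   spinShift_of stub_pairingBound stub_kirchhoff stub_siteRegrouping stub_traceIdentity stub_precompactTransfer)

/-- **WEAK ALTERNATING-MODE NULL** (nothing asserted): for every Dobrushin domain, every guarded discretisation family and every
admissible test function, `δ^{5/3} · Σ_v (E₀ − E₁ + E₂ − E₃)(v) ∂φ(δv) → 0` as `δ → 0⁺` (`ScaledNull (P2 Λ φ)` in the vocabulary of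
the proved crux `CoherentMorera`, line `finitary-green-pairing`). The weakest hypothesis from `EdgeCoherence` that the route's `closes` needs. -/
def WeakAlternatingModeNull : Prop :=
  ∀ (D : DobrushinDomain) (Λ : ℝ → DiscreteDobrushin), Guards D Λ → ∀ φ : ℂ → ℂ, TestFn D φ →
    ScaledNull (P2 Λ φ)

/-- The pointwise piece implies the weak form (landed `scaledNull_P2_of_alternatingModeNull`). -/
theorem weakAlternatingModeNull_of_alternatingModeNull : AlternatingModeNull → WeakAlternatingModeNull :=
  fun h2 D Λ hG φ hT => scaledNull_P2_of_alternatingModeNull h2 D Λ hG φ hT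

/-- **Both conclusions of `CoherentMorera` from the WEAK alternating mode + `EdgePrecompact`** (the landed proof of
`coherentMoreraConclusion_of_alternatingModeNull` with the weak hypothesis fed directly: spin shift + pairing bound + Kirchhoff give
`ScaledNull P₀` from `ScaledNull P₂`; site regrouping + trace identity give the vertex pairing; precompactness transfers).
[cite: DuminilCopinSmirnov2012Lattice, Conjecture 8.7] -/
theorem coherentMoreraConclusion_of_weakAlternatingModeNull : WeakAlternatingModeNull → EdgePrecompact → (∀ (D : DobrushinDomain) (Λ : ℝ → DiscreteDobrushin), (∀ δ, (Λ δ).Ω = D.carrier) → (∀ δ, (Λ δ).δ = δ) → (∀ᶠ δ in 𝓝[>] (0:ℝ), (Λ δ).IsZdAdmissible) → ∀ φ : ℂ → ℂ, ContDiff ℝ (⊤ : ℕ∞) φ → HasCompactSupport φ → tsupport φ ⊆ D.carrier → ScaledNull (PV Λ φ)) ∧ (∀ (D : DobrushinDomain) (Λ : ℝ → DiscreteDobrushin), (∀ δ, (Λ δ).Ω = D.carrier) → (∀ δ, (Λ δ).δ = δ) → (∀ᶠ δ in 𝓝[>] (0:ℝ), (Λ δ).IsZdAdmissible) → VertexPrecompactAt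 D Λ) := by
  intro hW hP
  refine ⟨?_, ?_⟩
  · intro D Λ hΩ hδ hadm φ hφ hsupp hsub
    have hG : Guards D Λ := ⟨hΩ, hδ, hadm⟩
    have hT : TestFn D φ := ⟨hφ, hsupp, hsub⟩
    have h0 : ScaledNull (P0 Λ φ) :=
      scaledNull_of_sub_of_or (spinShift_of stub_pairingBound stub_kirchhoff D Λ hG φ hT)
        (Or.inr (hW D Λ hG φ hT))
    exact (stub_siteRegrouping D Λ hG (stub_traceIdentity D Λ hG) φ hT).2 h0
  · intro D Λ hΩ hδ hadm
    exact stub_precompactTransfer hP D Λ ⟨hΩ, hδ, hadm⟩ (stub_traceIdentity D Λ ⟨hΩ, hδ, hadm⟩)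

end Summit.CriticalPhenomena.CardyFormulaZ2.Cruxes.EdgeCoherence.HarmonicSplit

end
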